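import Summits.ABC.IUTFork.Cor312HullFrameReal
import Mathlib.NumberTheory.Padics.ProperSpace
import HarnessLib

/-!
# [IUTchIII] Cor. 3.12 support — a lattice automorphism preserving `𝒪_L` that does NOT map hull-sets to hull-sets

PROOF-ONLY kernel witness (abc-iut cell, seat abc-iut-w5-d060, WAVE-5) for the SCOPE NOTE of p424693
`Cor312HullGluedStable` / p418697 `Cor312HullGlued`. TAKES NO SIDE on [IUTchIII] Cor. 3.12; no definition, no `Prop`
fact (the shear is characterised by the hypothesis `hΨ : ∀ x, Ψ x = ![x 0, x 0 + x 1]` and built inside the final proof).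

The hull-gluing files carry the hypothesis `hHul`: every indeterminacy maps EVERY hull-set `λ·𝒪_L` ([IUTchIII]
Rmk. 3.9.5 (i); campaign-S `IsHullSet`, a polydisc with all radii nonzero) of the packet frame to a hull-set. At the
Dupuy–Hilado-level real setting the (Ind2) slot is the group of ALL (bicontinuous) lattice automorphisms of the
log-shell (`Real.ismDH`, Dupuy–Hilado §4.9 "`ℤ_p`-lattice isomorphisms of `I_v`"). THIS FILE shows, on the smallest
possible carrier `L = ℚ_p ⊕ ℚ_p` (`K := fun _ : Fin 2 => ℚ_[p]`), that preserving the lattice `𝒪_L` is NOT enough for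
`hHul`. For a linear `Ψ` acting as the SHEAR `(x, y) ↦ (x, x + y)`:

* `image_unitHullSet_of_shear` — `Ψ` maps the unit hull-set `𝒪_L = ℤ_p × ℤ_p` ONTO itself (a lattice automorphism);
* `not_isHullSet_image_of_shear` — `Ψ` maps the hull-set `(1, p)·𝒪_L = ℤ_p × pℤ_p` to
  `{(a, b) | a ∈ ℤ_p, b − a ∈ pℤ_p}`, which is NO hull-set (it contains `(1, 1)` but not `(0, 1)`);
* **`exists_latticeAut_not_mapsHul`** — hence a linear automorphism of `L` preserving `𝒪_L` for which the
  `hHul`-clause of `Cor312HullGlued` FAILS at abc-iut-c312-7's real frame `HullFrame.ofLocalFields`: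
  `∃ Ψ, Ψ '' 𝒪_L = 𝒪_L ∧ ¬ ∀ H ∈ (ofLocalFields K).Hul, Ψ '' H ∈ (ofLocalFields K).Hul`.

Reading (neutral): `hHul` is a property of permutation / unit-isometry / field-automorphism indeterminacies, not of
DH's full lattice-automorphism group; the hull-gluing bracket at the DH setting therefore rests on ONE-SET stability of
`^{n,∘}𝒰` (p424693), packet by packet. Nothing of [IUTchIII] is asserted. [cite: DupuyHilado2025, §4.9]
[claim: Mochizuki2012, status: disputed] vocabulary only.
-/

noncomputable section

open Set

namespace Summit.ABC.IUTFork.Cor312.HullShear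

open Literature.IUT.LogVolume

variable {p : ℕ} [Fact p.Prime]

/-- **A shear is a lattice automorphism of `𝒪_L`**: it maps the unit hull-set `ℤ_p × ℤ_p` of `ℚ_p ⊕ ℚ_p` onto itself
(ultrametric inequality). [folklore] -/
theorem image_unitHullSet_of_shear (Ψ : (Fin 2 → ℚ_[p]) ≃ₗ[ℚ_[p]] (Fin 2 → ℚ_[p]))
    (hΨ : ∀ x, Ψ x = ![x 0, x 0 + x 1]) :
    ⇑Ψ '' hullSet (fun _ : Fin 2 => ℚ_[p]) 1 = hullSet (fun _ : Fin 2 => ℚ_[p]) 1 := by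
  ext y
  constructor
  · rintro ⟨x, hx, rfl⟩
    rw [hullSet, mem_polydisc] at hx ⊢
    have h0 := hx 0
    have h1 := hx 1
    simp only [Pi.one_apply, norm_one] at h0 h1
    intro j
    fin_cases j
    · simpa [hΨ] using h0
    · have h := IsUltrametricDist.norm_add_le_max (x 0) (x 1)
      simpa [hΨ] using h.trans (max_le h0 h1)
  · intro hy
    rw [hullSet, mem_polydisc] at hy
    have h0 := hy 0
    have h1 := hy 1
    simp only [Pi.one_apply, norm_one] at h0 h1
    refine ⟨![y 0, y 1 - y 0], ?_, ?_⟩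
    · rw [hullSet, mem_polydisc]
      intro j
      fin_cases j
      · simpa using h0
      · have h : ‖y 1 - y 0‖ ≤ max ‖y 1‖ ‖y 0‖ := by
          have h' := IsUltrametricDist.norm_add_le_max (y 1) (-(y 0))
          rwa [norm_neg, ← sub_eq_add_neg] at h'
        simpa using h.trans (max_le h1 h0)
    · rw [hΨ]
      ext j
      fin_cases j
      · simp
      · simp

/-- **The shear image of the hull-set `ℤ_p × pℤ_p` is not a hull-set**: it contains `(1, 1) = Ψ (1, 0)`, so a
hull-set containing it has both radii `≥ 1` and contains `(0, 1)`; but `Ψ x = (0, 1)` forces `x = (0, 1)`, and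
`‖1‖ > ‖p‖`. [folklore] -/
theorem not_isHullSet_image_of_shear (Ψ : (Fin 2 → ℚ_[p]) ≃ₗ[ℚ_[p]] (Fin 2 → ℚ_[p]))
    (hΨ : ∀ x, Ψ x = ![x 0, x 0 + x 1]) :
    ¬ IsHullSet (fun _ : Fin 2 => ℚ_[p]) (⇑Ψ '' hullSet (fun _ : Fin 2 => ℚ_[p]) ![(1 : ℚ_[p]), (p : ℚ_[p])]) := by
  rintro ⟨d, hd, heq⟩
  -- `(1, 1)` lies in the image
  have h11 : (![(1 : ℚ_[p]), 1] : Fin 2 → ℚ_[p]) ∈ hullSet (fun _ : Fin 2 => ℚ_[p]) d := by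
    rw [← heq]
    refine ⟨![1, 0], ?_, ?_⟩
    · rw [hullSet, mem_polydisc]
      intro j
      fin_cases j
      · simp
      · simp
    · rw [hΨ]
      ext j
      fin_cases j
      · simp
      · simp
  rw [hullSet, mem_polydisc] at h11
  -- hence `(0, 1)` lies in the hull-set `d·𝒪`
  have h01 : (![(0 : ℚ_[p]), 1] : Fin 2 → ℚ_[p]) ∈ hullSet (fun _ : Fin 2 => ℚ_[p]) d := by
    rw [hullSet, mem_polydisc]
    intro j
    fin_cases j
    · simp
    · simpa using h11 1
  -- … so in the image: `(0, 1) = Ψ x` with `x ∈ ℤ_p × pℤ_p` forces `x = (0, 1)`, `‖1‖ ≤ ‖p‖`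
  rw [← heq] at h01
  obtain ⟨x, hx, hx01⟩ := h01
  rw [hullSet, mem_polydisc] at hx
  rw [hΨ] at hx01
  have hx0 : x 0 = 0 := by
    have := congrFun hx01 0
    simpa using this
  have hx1 : x 1 = 1 := by
    have := congrFun hx01 1
    simpa [hx0] using this
  have h := hx 1
  rw [hx1, norm_one] at h
  have hlt : ‖(![(1 : ℚ_[p]), (p : ℚ_[p])] : Fin 2 → ℚ_[p]) 1‖ < 1 := by
    simpa using Padic.norm_p_lt_one (p := p)
  exact absurd (lt_of_le_of_lt h hlt) (lt_irrefl _)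

variable (p) in
/-- **A lattice automorphism of `𝒪_L` under which `hHul` fails at the real frame.** On `L = ℚ_p ⊕ ℚ_p` there is a
linear automorphism (the shear `(x, y) ↦ (x, x + y)`) mapping `𝒪_L` onto itself — the shape of an element of
Dupuy–Hilado's (Ind2) group — that does NOT map every hull-set of abc-iut-c312-7's `HullFrame.ofLocalFields` to a
hull-set. [cite: DupuyHilado2025, §4.9] -/
theorem exists_latticeAut_not_mapsHul :
    ∃ Ψ : (Fin 2 → ℚ_[p]) ≃ₗ[ℚ_[p]] (Fin 2 → ℚ_[p]),
      ⇑Ψ '' hullSet (fun _ : Fin 2 => ℚ_[p]) 1 = hullSet (fun _ : Fin 2 => ℚ_[p]) 1 ∧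
      ¬ ∀ H ∈ (HullFrame.ofLocalFields (fun _ : Fin 2 => ℚ_[p])).Hul,
        ⇑Ψ '' H ∈ (HullFrame.ofLocalFields (fun _ : Fin 2 => ℚ_[p])).Hul := by
  have hp : (p : ℚ_[p]) ≠ 0 := by exact_mod_cast (Fact.out : p.Prime).ne_zero
  -- the shear as a linear automorphism
  let Ψ : (Fin 2 → ℚ_[p]) ≃ₗ[ℚ_[p]] (Fin 2 → ℚ_[p]) :=
    { toFun := fun x => ![x 0, x 0 + x 1]
      invFun := fun y => ![y 0, y 1 - y 0]
      map_add' := fun x y => by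
        ext j
        fin_cases j
        · simp
        · simp only [Pi.add_apply, Fin.mk_one, Matrix.cons_val_one, Matrix.cons_val_zero]
          ring
      map_smul' := fun c x => by
        ext j
        fin_cases j
        · simp
        · simp only [Pi.smul_apply, smul_eq_mul, RingHom.id_apply, Fin.mk_one, Matrix.cons_val_one,
            Matrix.cons_val_zero]
          ring
      left_inv := fun x => by
        ext j
        fin_cases j
        · simp
        · simp
      right_inv := fun y => by
        ext j
        fin_cases j
        · simp
        · simp }
  have hΨ : ∀ x, Ψ x = ![x 0, x 0 + x 1] := fun x => rfl
  have hc : ∀ j : Fin 2, (![(1 : ℚ_[p]), (p : ℚ_[p])] : Fin 2 → ℚ_[p]) j ≠ 0 := by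
    intro j
    fin_cases j
    · simp
    · simpa using hp
  exact ⟨Ψ, image_unitHullSet_of_shear Ψ hΨ, fun h =>
    not_isHullSet_image_of_shear Ψ hΨ (h _ ⟨_, hc, rfl⟩)⟩

end Summit.ABC.IUTFork.Cor312.HullShear

end
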